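import Summits.QuantumFields.BalabanUV.T4Continuum.Support.NE9CurChartTowerPiLipschitzAtFlatLatticeUniformC

/-!
# NE9CurChartTowerPiLipschitzAtFlatLatticeUniformCTopLevel — (TOP-LEVEL (115) PROFILE `lev ≡ n+1`, `ω = Ω = 1`) THE CHART OF THE CURVE SPECIES `cur U` FOR PRINT's `k`-TH-STEP OPERATOR (3.122) IS LIPSCHITZ IN THE
# BACKGROUND AT THE FLAT POINT WITH ONE CONSTANT FOR EVERY HEIGHT `k = n+1`, EVERY SPACING ON THE DIAGONAL, EVERY PERIOD `m`: for every background `U` of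
# the cell's MODEL block, every pair of admissible (L3) slots with a background modulus `δ_W` on one ball, and every `B ∈ ball 0 R_b`:
# `‖ι(chart_U B) − chart_1 B‖_(115),∇_1 ≤ K·((j₀ + α) + δ_W)` with `α₁ j₁ ε₄ ε_C R_b r K` BEFORE `∀ n η m U` — the sibling `NE9CurChartTowerPiLipschitzAtFlatLatticeUniform`
# (this seat, gen 104) WITH ITS DISPLAYED `C_k`-MODULUS `δ_C` DISCHARGED by `B11Eq44COperatorTowerTwoBackgrounds.sectC_modulus_tower` ([B7] Prop. 7 at `k` levels read as a
# background modulus: `δ_C = (24∕r′)·α·(ε_C + a_C)`, `r′` = Prop. 7's polydisc radius in coarse units — the five smallness inequalities of Prop. 7's regime DISPLAYED as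
# numerics on `(α₀, r′, r)`); cell `pub-balaban`, T4-DAG §2 node U3 ∕ §6 NE9, WALL-NE9-P1 §3 (ii); NE9 crux-team (2) LEAF PROVER 01 (`b2b-balaban-t4-ne9-formalise-leaf-01`,
# gen 104); Summits-side NEW leaf under this seat's INTERFACE REQUEST NE9 [NE9LEAF01-G104-IFR-2] (HOME/INBOX.md; ruling e34b3e0c (0)); the pattern of gen 98's
# `NE9CurChartTowerPiLatticeUniformClassW80VJDeltaTopLevel`; nothing printed asserted

HONEST FRAMING (T4-DAG PAGE 1).  Rung (B)+1 of the FINITE-VOLUME T⁴ programme — NOT infinite volume, NOT a mass gap, NOT the Clay problem.  NE9 is a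
cell NEW ESTIMATE, NOT PRINTED in [Balaban1987RG1] ∕ [Balaban1988RG2Cluster], and NOT PROVED here («NE9 ⇐ the named binders»; spine PROVED 0∕9).  HONEST
DEPENDENCY (cell line, verbatim): continuum YM on T⁴ ⇐ BetaPertH ∧ nine spine estimates (0/9 proved); BetaPertH ⇐ (D1) ∧ (D4) ∧ CAP+tail; G-an2-4
gates asym, D1 and NE2/3/4.  The `cur U` OBJECT is ONE item of the MODEL O-NE9-1 (species (a) data); `act` ∕ `ker` and NEEDS-COORDINATOR #5 untouched.

WHAT THIS FILE PROVES (ONE theorem; 0 def, 0 sorry, axioms standard).  **`cur_chart_tower_pi_lipschitz_at_flat_lattice_uniform_C_topLevel`** — the sibling `…C` read at the top-level (115) profile `lev₀ = lev₁ ≡ n+1` (weights `w̄ = w̲⁻¹ = 1` on the diagonal, `NE9CurChartTowerPiLatticeUniformFlatWitness.topLevel_weights` ∕ `zeroExp_weights`), ANY `levB`: the ∀-block is print's class data, the two (L3) slots with `δ_W`, and `B` only —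
for fixed `L`, the fibre ∕ trace letters, print's `a, a′ > 0`, the level-profile room `(ϱ, AQ, ρ_w)`, `C_k`'s numerics (`G ≤ U1` averaging-closed, `α₀`, `ρ`), the (L3)
constants `(C₄, a₃)`, two numbers `ω, Ω ≥ 0` bounding the (115) weight profile, and the realification basis `b` of `𝔸`: `∃ α₁ j₁ ε₄ ε_C R_b r K` (all `> 0`) BEFORE
`∀`, such that for EVERY height `n`, spacing `η` on the diagonal, period `m`, background `U` with the MODEL block's data VERBATIM (the binder block of this lineage's
`B11Eq174ChartLipschitzAtFlatLatticeFreeClosed.exists_chartHB_lipschitz_at_flat_latticeFree`: per-level profile, windows, unitarity, ANY positivity ∕ onto witnesses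
`hpos′ hpos hposπ hQ` at `U` and `hpos′₁ hpos₁ hQ1` at the vacuum), `Ũ ∈ G`, the TOP-LEVEL profile `lev₀ = lev₁ ≡ n+1` (no weight binders) and any `levB`,
every pair of (L3) slots `W₁` (over `∇_U`), `W₂` (over `∇_1`) with `QuadAnalytic · C₄ a₃`, every DISPLAYED modulus `δ_W ≥ 0` with `‖W₁P − W₂(ιP)‖ ≤ δ_W` on `‖P‖ < r`,
and every `B` with `‖B‖ < R_b`:
`‖ι(chartHB 𝔊̃_k(U) 0 W₁ 0 (A′ ↦ A′ + solA H̃_{1,k}(U) 0 C_k(U) 0 ε_C A′) ε₄ H̃_{1,k}(U) B) − chartHB 𝔊_k(1) 0 W₂ 0 (…) ε₄ H_{1,k}(1) B‖ ≤ K·((j₀ + α) + δ_W)`.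
PROOF = (Z)'s outer assembly at the tower with LATTICE-FREE suppliers: `exists_chartHB_lipschitz_at_flat_latticeFree` (the chart-level composition with the letter
defects `δ̃_A`, `δ̃_G`, `K_ι` PRODUCED free of the lattice — ROUTE (J′): this lineage's gens 99–104, the located letter `Hω` discharged in gen 104); the two operator norms
`exists_norm_chartLetters_le` at `U` and at the vacuum (the vacuum is in the class with `α = 0`, `j₀ = 0`: `NE9CurChartTowerPiLatticeUniformFlatWitness.flat_mem_class`; print's
letters at the vacuum ARE the chain's: `B9Eq3119DeltaPiTowerFlat.letters_laplaceAkPi_one`, §1); the scalar letters WITH ROOM `B11Eq118RegimeScalars.exists_twoRegimes_radii_of_bounds_room_cap`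
at `(B₀, b, b₁) := ω·M_φBM_φ′·Ω`, `(C₂, c₄) := (C2T d α₀, ρ)`; `C_k`'s `QuadAnalytic` at `U` and at `1` (`B11Eq44CLetterTower.quadAnalytic_Cck`, (52) from the plaquette
window); the radius bookkeeping `ρ := 2(ε₄ + a)`, `s := ε₄ + a` under `K_ι = 1 + w̄₁·2α·w̲₁⁻¹ ≤ 2` (`α ≤ 1∕(2ωΩ + 1)`); `δ_C` from `sectC_modulus_tower` at
`ρ′ := r′∕L^{n+1}`, `ρ := r∕L^{n+1}`, `ε := αη` (`L^{n+1}αη = α`), the Sect. C ball capped at `r∕2` (`6α ≤ r′`).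
DISGUISE TEST: composition by name of landed theorems; no inequality of the series proved HERE; constants crude and symbolic (NOT print's `B₀`); `j₀` and `α`
displayed separately; the per-level profile, the positivity ∕ surjectivity witnesses, the weight-profile bounds, the (L3) slots WITH their modulus `δ_W` and Prop. 7's
numerics stay DISPLAYED (δ_W's lattice-free discharge = the successor's bricks: the (3.122) current letter, the V₀-group, the junction `B11Eq98W80ModulusLetterDefects`);
NOT the gauge step of p. 416, NOT claimed that Bałaban's 𝐇_k ∕ U_j(□₀, exp iB) meet these letters (O-NE9-1; #5 UNRULED); not NE9.  What IS new relative to (Z): NO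
constant depends on the height, the spacing or the period.
References (TYPES ∕ loci only): [Balaban1985Variational] (44)–(47) p. 285, (103) p. 293, Prop. 6 (117)–(121) p. 295, (172)–(175) p. 305, Prop. 9 p. 309;
[Balaban1985BackgroundPropagators] (3.35)–(3.37) p. 396, Thm 3.1 (3.42)∕(3.47) pp. 397–398, Thm 3.4 p. 400, (3.122)–(3.126) p. 420, (3.152)–(3.153) p. 426, Thm 3.13 p. 426;
[Balaban1985Averaging] Prop. 2 (52)–(54) p. 26.
-/

noncomputable section

open Metric Set

namespace Summit.QuantumFields.BalabanUV.T4Continuum.NE9CurChartTowerPiLipschitzAtFlatLatticeUniformCTopLevel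

open scoped InnerProductSpace ComplexConjugate BigOperators
open Literature.MathematicalPhysics.QuantumFieldTheory.Balaban1983to89
open B11Eq103H1Complex B11Eq115Space B11Eq174Chart
open B11Eq111FrakG (nabla115 jetLinearEquiv)
open B13Contraction113 (QuadAnalytic)
open B9SectCLatticeCarrier (Bond bpos btgt shift unshift)
open B4Sect5Torus (TSite)
open B7Prop1Explicit (U1 Wcx boxVec)
open B7Prop2Explicit (pdev AvgClosed C0 c2')
open B7Prop3Flat (c3)
open B9Eq315QTorus (perCfg cornerSite)
open B9Eq315QTower (towerP UlevOf)
open B9Eq315QTowerFlat (perCfg_UlevOf_one_mem_U1 norm_Wcx_UlevOf_one_sub_one_le UlevOf_one)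
open B9Eq326OperatorTower (QkW laplaceAk RofUk)
open B9Eq310HessianOperator (adTransportW hessOp)
open B9Eq310DeltaPrime (plaqHolU plaqHolU_one)
open B9Eq324DeltaPrimeATower (laplacePrimeAk)
open B9Eq3119DeltaPiTower (laplaceAkPi)
open B9Eq3119DeltaPiTowerFlat (laplaceAkPi_one_pos_iff letters_laplaceAkPi_one)
open B11Eq118RegimeScalars (exists_twoRegimes_radii_of_bounds_room_cap)
open B11Eq44COperatorTower (C2T C2T_nonneg)
open B11Eq44CLetterTower (Cck quadAnalytic_Cck)
open B7Eq43AveragedSmallnessLevelFree (pdev_perCfg_le_of_plaq)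
open B11Eq117ChartLettersOnModel (exists_norm_chartLetters_le)
open B11Eq174ChartLipschitzAtFlatLatticeFreeClosed (exists_chartHB_lipschitz_at_flat_latticeFree)
open Summit.QuantumFields.BalabanUV.T4Continuum.NE9CurChartTowerPiLatticeUniformFlatWitness (flat_mem_class)
open Summit.QuantumFields.BalabanUV.T4Continuum.NE9CurChartTowerPiLipschitzAtFlatLatticeUniform (frakGLatticeCLM_laplaceAkPi_one H1LatticeCLM_laplaceAkPi_one)
open Summit.QuantumFields.BalabanUV.T4Continuum.NE9CurChartTowerPiLipschitzAtFlatLatticeUniformC (cur_chart_tower_pi_lipschitz_at_flat_lattice_uniform_C)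
open Summit.QuantumFields.BalabanUV.T4Continuum.NE9CurChartTowerPiLatticeUniformFlatWitness (topLevel_weights zeroExp_weights)

variable {d : ℕ} (hd : 1 ≤ d) (L : ℕ) [NeZero L] (hL : 1 ≤ L) (hL2 : 2 ≤ L) (hL3 : 3 ≤ L) [Fact (0 < (L : ℝ))]
  {𝔸 : Type*} [NormedRing 𝔸] [NormedAlgebra ℂ 𝔸] [CompleteSpace 𝔸] [NormOneClass 𝔸] [StarRing 𝔸] [NormedStarGroup 𝔸] [StarModule ℂ 𝔸] [FiniteDimensional ℂ 𝔸]
  {W : Type*} [NormedAddCommGroup W] [InnerProductSpace ℂ W] [FiniteDimensional ℂ W] (φ : W ≃ₗ[ℂ] 𝔸)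
  {Mφ Mφ' : ℝ} (hMφ : 0 ≤ Mφ) (hMφ' : 0 ≤ Mφ') (hφ : ∀ w, ‖φ w‖ ≤ Mφ * ‖w‖) (hφ' : ∀ X, ‖φ.symm X‖ ≤ Mφ' * ‖X‖) (hstar : ∀ X : 𝔸, ‖star X‖ ≤ ‖X‖)
  {a : ℝ} (ha : 0 < a) {a' : ℝ} (ha' : 0 < a') {ϱ : ℝ} (hϱ0 : 0 ≤ ϱ) (hϱ1 : ϱ < 1)
  (τ : 𝔸 →ₗ[ℂ] ℂ) {Cτ : ℝ} (hτ : ∀ X, ‖τ X‖ ≤ Cτ * ‖X‖) (hCτ : 0 ≤ Cτ) {Mτ : ℝ} (hτm : ∀ X Y : 𝔸, ‖τ (X * Y)‖ ≤ Mτ * ‖X‖ * ‖Y‖) (hMτ : 0 ≤ Mτ)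
  {ρw : ℝ} (hρw : 0 ≤ ρw)
  (hτ₁ : ∀ X : 𝔸, τ (star X) = conj (τ X)) (hτ₂ : ∀ X Y : 𝔸, τ (X * Y) = τ (Y * X)) (hφτ : ∀ X Y : 𝔸, ⟪φ.symm X, φ.symm Y⟫_ℂ = τ (star X * Y))
  (AQ : ℝ)
  {ι : Type} [Fintype ι] [DecidableEq ι] (b : Module.Basis ι ℝ 𝔸) {M₂ : ℝ} (hM₂ : 0 ≤ M₂) (hrepr : ∀ (v : 𝔸) (i : ι), |b.repr v i| ≤ M₂ * ‖v‖)
  {G : Subgroup 𝔸ˣ} (hG : AvgClosed d L G) {α₀ : ℝ} (hα₀ : 0 < α₀) (hα3 : C0 d * α₀ ≤ 1 / 3) (hα4 : 4 * α₀ ≤ c2' d L)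
  {ρ : ℝ} (hρ0 : 0 < ρ) (hρ : Real.exp (4 * (800 * ((d : ℝ) + 1) ^ 2 * ((d : ℝ) + 4)) * α₀) * (1 + 8 * (131072 * ((d : ℝ) + 1) ^ 2) * ρ) ≤ 2)
  (hρc : 2 * ρ ≤ c3 d L) {C₄ a₃ : ℝ} (hC₄ : 0 ≤ C₄) (ha₃ : 0 < a₃)
  (hα8 : 8 * α₀ ≤ c2' d L) {r' r₇ : ℝ} (hr' : 0 < r') (hr₇ : 0 < r₇)
  (h7s' : Real.exp (4 * (800 * ((d : ℝ) + 1) ^ 2 * ((d : ℝ) + 4)) * α₀) * (1 + 8 * (131072 * ((d : ℝ) + 1) ^ 2) * r') ≤ 2)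
  (h7c' : 2 * r' ≤ c3 d L) (h7r'1 : 409600 * ((d : ℝ) + 1) ^ 2 * r' ≤ 1)
  (h7s : Real.exp (4480 * ((d : ℝ) + 1) ^ 2 * ((d : ℝ) + 4) * α₀ + 240000 * ((d : ℝ) + 1) ^ 3 * r') * (1 + 8 * (2097152 * ((d : ℝ) + 1) ^ 2) * r₇) ≤ 2)
  (h7c : 2 * r₇ ≤ c3 d L / 4)

/-! ## The face with `δ_C` discharged, at the top-level (115) profile -/

-- deep definitional unfolding `laplaceAkPi` ↦ `laplaceALatticeK … (π†Δπ) …` in the statement (as the host)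
set_option maxRecDepth 8192 in
set_option maxHeartbeats 9600000 in
include hd hL hL2 hL3 hMφ hMφ' hφ hφ' hstar ha ha' hϱ0 hϱ1 hτ hCτ hτm hMτ hρw hτ₁ hτ₂ hφτ hM₂ hrepr hG hα₀ hα3 hα4 hρ0 hρ hρc hC₄ ha₃ hα8 hr' hr₇ h7s' h7c' h7r'1 h7s h7c in
/-- **THE CHART OF `cur U` AT PRINT's OPERATOR (3.122) IS LIPSCHITZ IN THE BACKGROUND AT THE FLAT POINT, LATTICE-UNIFORMLY** — see the module header:
`‖ι(chart_U B) − chart_1 B‖ ≤ K·((j₀ + α) + δ_W)` for every lattice of the tower, every background of the MODEL block, `B ∈ ball 0 R_b`, with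
`α₁ j₁ ε₄ ε_C R_b r K` BEFORE `∀`; the (L3) slots' modulus `δ_W` displayed, `δ_C` DISCHARGED. [folklore]
[cite: Balaban1985Variational, Prop. 6 (116)–(121) p.295, (117) p.295, (174)–(175) p.305, (47) p.284, Prop. 9 p.309; Balaban1985BackgroundPropagators, Thm 3.4 p.400, (3.122) p.420, (3.126) p.420, (3.153) p.426, Thm 3.13 p.426] -/
theorem cur_chart_tower_pi_lipschitz_at_flat_lattice_uniform_C_topLevel :
    ∃ α₁ j₁ ε₄ εC Rb r K : ℝ, 0 < α₁ ∧ 0 < j₁ ∧ 0 < ε₄ ∧ 0 < εC ∧ 0 < Rb ∧ 0 < r ∧ 0 < K ∧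
      ∀ (n : ℕ) (η : ℝ) [Fact (0 < η)] (_hηL : η * (L : ℝ) ^ (n + 1) = 1) (c₀ c₁ : ℝ) [Fact (0 < c₀)] [Fact (0 < c₁)]
        (_hw : c₀ * ((L : ℝ) ^ (n + 1)) ^ d = c₁) (_hρ : |η| ^ d / c₀ ≤ ρw) (m : Fin d → ℕ) [∀ i, NeZero (m i)] (_hm : ∀ i, 1 ≤ m i)
        (U : Bond d (towerP L m (n + 1)) → 𝔸ˣ) (αU : ℕ → ℝ) (_hα0 : ∀ j, 0 ≤ αU j) (hα1 : ∀ j, αU j ≤ 1 / 64)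
        (_hαL : ∀ j, 50 * (d + 1) * αU j * (L : ℝ) ^ d ≤ 1 / 2)
        (hU1 : ∀ (j : ℕ) (x : B7Prop1Explicit.Site d) (k : Fin d), perCfg (towerP L m (j + 1)) (UlevOf L m (n + 1) U j) x k ∈ U1 𝔸)
        (hreg : ∀ (j : ℕ) (y : TSite d (towerP L m j)) (k : Fin d) (ρ' : Fin d → Fin L),
          ‖((Wcx L (perCfg (towerP L m (j + 1)) (UlevOf L m (n + 1) U j)) (cornerSite L y) k (boxVec L ρ') : 𝔸ˣ) : 𝔸) - 1‖ ≤ αU j)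
        (εU : ℕ → ℝ) (_hεU : ∀ j, 0 ≤ εU j) (_hε1 : ∀ j, εU j ≤ 1) (_hUε : ∀ (j : ℕ) (b : Bond d (towerP L m (j + 1))), ‖(UlevOf L m (n + 1) U j b : 𝔸) - 1‖ ≤ εU j)
        (_hLb : ∀ (j : ℕ) (b : Bond d (towerP L m (j + 1))), UlevOf L m (n + 1) U j b ∈ U1 𝔸)
        (α : ℝ) (_hα : 0 ≤ α) (_hαle : α ≤ α₁)
        (hUst : ∀ b, star (U b : 𝔸) = (((U b)⁻¹ : 𝔸ˣ) : 𝔸)) (_hUb : ∀ b, U b ∈ U1 𝔸) (_hUη : ∀ b, ‖(U b : 𝔸) - 1‖ ≤ α * η)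
        (_hUw : ∀ (x : TSite d (towerP L m (n + 1))) (μ ν : Fin d), ‖(U (shift ν x, μ) : 𝔸) - (U (x, μ) : 𝔸)‖ ≤ α * η ^ 2)
        (_hpl : ∀ p : B9SectCLatticeCarrier.Plaq d (towerP L m (n + 1)), ‖(plaqHolU U p : 𝔸) - 1‖ ≤ α * η ^ 2)
        (_hUgrad : ∀ (x : TSite d (towerP L m (n + 1))) (μ : Fin d), ‖(U (x, μ) : 𝔸) - U (unshift μ x, μ)‖ ≤ α * η ^ 2)
        (_hRlev : ∀ (j : ℕ) (b : Bond d (towerP L m (j + 1))) (w : W), ‖adTransportW φ (UlevOf L m (n + 1) U j) b w‖ ≤ ‖w‖)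
        (_hεg : ∀ j < n + 1, εU j ≤ α * ϱ ^ j) (_hAQ : ∑ j ∈ Finset.range (n + 1), αU j ≤ AQ)
        (hpos' : ∀ x : SiteL2K ℂ d (towerP L m (n + 1)) c₀ W, x ≠ 0 → 0 < RCLike.re ⟪x, laplacePrimeAk L m n φ η U a' (c₁ := c₁) x⟫_ℂ)
        (hpos : ∀ x : BondL2K ℂ d (towerP L m (n + 1)) c₀ W, x ≠ 0 →
          0 < RCLike.re ⟪x, laplaceAk L m n φ η U hL αU hα1 hU1 hreg τ (c₀ := c₀) (c₁ := c₁) a x⟫_ℂ)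
        (_hc₀η : c₀ = η ^ d) (j₀ : ℝ) (_hJ : ∀ μ y, ‖B9Eq39Adjoint.J (fun μ => B9Eq33CovDerivVector.shiftEquiv μ) (fun μ y => U (y, μ)) η μ y‖ ≤ j₀) (_hj : j₀ ≤ j₁)
        (hposπ : ∀ x : BondL2K ℂ d (towerP L m (n + 1)) c₀ W, x ≠ 0 →
          0 < RCLike.re ⟪x, laplaceAkPi L m n φ τ η U a' hpos' hL αU hα1 hU1 hreg (c₁ := c₁) a x⟫_ℂ)
        (hQ : Function.Surjective (QkW L m n φ U hL αU hα1 hU1 hreg (c₀ := c₀) (c₁ := c₁)))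
        (hpos'₁ : ∀ x : SiteL2K ℂ d (towerP L m (n + 1)) c₀ W, x ≠ 0 →
          0 < RCLike.re ⟪x, laplacePrimeAk L m n φ η (fun _ : Bond d (towerP L m (n + 1)) => (1 : 𝔸ˣ)) a' (c₁ := c₁) x⟫_ℂ)
        (hpos₁ : ∀ x : BondL2K ℂ d (towerP L m (n + 1)) c₀ W, x ≠ 0 →
          0 < RCLike.re ⟪x, laplaceAk L m n φ η (fun _ : Bond d (towerP L m (n + 1)) => (1 : 𝔸ˣ)) hL (fun _ => 0) (fun _ => by norm_num)
            (perCfg_UlevOf_one_mem_U1 L m (n + 1)) (norm_Wcx_UlevOf_one_sub_one_le L m (n + 1) (fun _ => 0) (fun _ => le_rfl)) τ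
            (c₀ := c₀) (c₁ := c₁) a x⟫_ℂ)
        (hQ1 : Function.Surjective (QkW L m n φ (fun _ : Bond d (towerP L m (n + 1)) => (1 : 𝔸ˣ)) hL (fun _ => 0) (fun _ => by norm_num)
          (perCfg_UlevOf_one_mem_U1 L m (n + 1)) (norm_Wcx_UlevOf_one_sub_one_le L m (n + 1) (fun _ => 0) (fun _ => le_rfl)) (c₀ := c₀) (c₁ := c₁)))
        (_hUG : ∀ (x : B7Prop1Explicit.Site d) (κ : Fin d), perCfg (towerP L m (n + 1)) U x κ ∈ G)
        (levB : Bond d m → ℕ)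
        {W₁ : Space115 (L : ℝ) η (fun _ : Bond d (towerP L m (n + 1)) => n + 1) (fun _ : Bond d (towerP L m (n + 1)) × Fin d => n + 1) (nabla115 η U) → NegSize (L : ℝ) η (fun _ : Bond d (towerP L m (n + 1)) => n + 1) 3 𝔸}
        {W₂ : Space115 (L : ℝ) η (fun _ : Bond d (towerP L m (n + 1)) => n + 1) (fun _ : Bond d (towerP L m (n + 1)) × Fin d => n + 1) (nabla115 η (fun _ : Bond d (towerP L m (n + 1)) => (1 : 𝔸ˣ))) → NegSize (L : ℝ) η (fun _ : Bond d (towerP L m (n + 1)) => n + 1) 3 𝔸}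
        (_hW₁ : QuadAnalytic W₁ C₄ a₃) (_hW₂ : QuadAnalytic W₂ C₄ a₃) {δW : ℝ} (_hδW0 : 0 ≤ δW)
        (_hδW : ∀ P : Space115 (L : ℝ) η (fun _ : Bond d (towerP L m (n + 1)) => n + 1) (fun _ : Bond d (towerP L m (n + 1)) × Fin d => n + 1) (nabla115 η U), ‖P‖ < r →
          ‖W₁ P - W₂ (LinearMap.toContinuousLinearMap
            ((jetLinearEquiv (L : ℝ) η (fun _ : Bond d (towerP L m (n + 1)) => n + 1) (fun _ : Bond d (towerP L m (n + 1)) × Fin d => n + 1) (nabla115 η (fun _ : Bond d (towerP L m (n + 1)) => (1 : 𝔸ˣ)))).symm.toLinearMap ∘ₗ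
              (jetLinearEquiv (L : ℝ) η (fun _ : Bond d (towerP L m (n + 1)) => n + 1) (fun _ : Bond d (towerP L m (n + 1)) × Fin d => n + 1) (nabla115 η U)).toLinearMap) P)‖ ≤ δW)
        (B : NegSize (L : ℝ) η levB 0 𝔸) (_hBb : ‖B‖ < Rb),
        ‖LinearMap.toContinuousLinearMap
              ((jetLinearEquiv (L : ℝ) η (fun _ : Bond d (towerP L m (n + 1)) => n + 1) (fun _ : Bond d (towerP L m (n + 1)) × Fin d => n + 1) (nabla115 η (fun _ : Bond d (towerP L m (n + 1)) => (1 : 𝔸ˣ)))).symm.toLinearMap ∘ₗ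
                (jetLinearEquiv (L : ℝ) η (fun _ : Bond d (towerP L m (n + 1)) => n + 1) (fun _ : Bond d (towerP L m (n + 1)) × Fin d => n + 1) (nabla115 η U)).toLinearMap)
            (chartHB (frakGLatticeCLM (L := (L : ℝ)) (η := η) (lev₀ := (fun _ : Bond d (towerP L m (n + 1)) => n + 1)) φ hposπ hQ (fun _ : Bond d (towerP L m (n + 1)) × Fin d => n + 1) (nabla115 η U)) 0 W₁ 0
              (fun A' => A' + solA (H1LatticeCLM (L := (L : ℝ)) (η := η) (lev₀ := (fun _ : Bond d (towerP L m (n + 1)) => n + 1)) (levB := levB) φ hposπ hQ (fun _ : Bond d (towerP L m (n + 1)) × Fin d => n + 1) (nabla115 η U)) 0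
                (Cck L m η (n + 1) U (fun _ : Bond d (towerP L m (n + 1)) => n + 1) (fun _ : Bond d (towerP L m (n + 1)) × Fin d => n + 1) (nabla115 η U) levB) 0 εC A') ε₄
              (H1LatticeCLM (L := (L : ℝ)) (η := η) (lev₀ := (fun _ : Bond d (towerP L m (n + 1)) => n + 1)) (levB := levB) φ hposπ hQ (fun _ : Bond d (towerP L m (n + 1)) × Fin d => n + 1) (nabla115 η U)) B) -
          chartHB (frakGLatticeCLM (L := (L : ℝ)) (η := η) (lev₀ := (fun _ : Bond d (towerP L m (n + 1)) => n + 1)) (c := ((η : ℂ))⁻¹)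
              (R := adTransportW φ (fun _ : Bond d (towerP L m (n + 1)) => (1 : 𝔸ˣ)))
              (S := adTransportW φ fun _ : Bond d (towerP L m (n + 1)) => (1 : 𝔸ˣ)⁻¹) (Δ₁ := hessOp φ η (fun _ : Bond d (towerP L m (n + 1)) => (1 : 𝔸ˣ)) τ)
              (Rr := RofUk L m n φ η (fun _ : Bond d (towerP L m (n + 1)) => (1 : 𝔸ˣ)))
              (Q := (QkW L m n φ (fun _ : Bond d (towerP L m (n + 1)) => (1 : 𝔸ˣ)) hL (fun _ => 0) (fun _ => by norm_num)
                (perCfg_UlevOf_one_mem_U1 L m (n + 1)) (norm_Wcx_UlevOf_one_sub_one_le L m (n + 1) (fun _ => 0) (fun _ => le_rfl)) (c₀ := c₀) (c₁ := c₁))) (a := a)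
              φ hpos₁ hQ1 (fun _ : Bond d (towerP L m (n + 1)) × Fin d => n + 1) (nabla115 η (fun _ : Bond d (towerP L m (n + 1)) => (1 : 𝔸ˣ)))) 0 W₂ 0
            (fun A' => A' + solA (H1LatticeCLM (L := (L : ℝ)) (η := η) (lev₀ := (fun _ : Bond d (towerP L m (n + 1)) => n + 1)) (levB := levB) (c := ((η : ℂ))⁻¹)
              (R := adTransportW φ (fun _ : Bond d (towerP L m (n + 1)) => (1 : 𝔸ˣ)))
              (S := adTransportW φ fun _ : Bond d (towerP L m (n + 1)) => (1 : 𝔸ˣ)⁻¹) (Δ₁ := hessOp φ η (fun _ : Bond d (towerP L m (n + 1)) => (1 : 𝔸ˣ)) τ)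
              (Rr := RofUk L m n φ η (fun _ : Bond d (towerP L m (n + 1)) => (1 : 𝔸ˣ)))
              (Q := (QkW L m n φ (fun _ : Bond d (towerP L m (n + 1)) => (1 : 𝔸ˣ)) hL (fun _ => 0) (fun _ => by norm_num)
                (perCfg_UlevOf_one_mem_U1 L m (n + 1)) (norm_Wcx_UlevOf_one_sub_one_le L m (n + 1) (fun _ => 0) (fun _ => le_rfl)) (c₀ := c₀) (c₁ := c₁))) (a := a)
              φ hpos₁ hQ1 (fun _ : Bond d (towerP L m (n + 1)) × Fin d => n + 1) (nabla115 η (fun _ : Bond d (towerP L m (n + 1)) => (1 : 𝔸ˣ)))) 0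
              (Cck L m η (n + 1) (fun _ : Bond d (towerP L m (n + 1)) => (1 : 𝔸ˣ)) (fun _ : Bond d (towerP L m (n + 1)) => n + 1) (fun _ : Bond d (towerP L m (n + 1)) × Fin d => n + 1) (nabla115 η (fun _ : Bond d (towerP L m (n + 1)) => (1 : 𝔸ˣ))) levB) 0 εC A') ε₄
            (H1LatticeCLM (L := (L : ℝ)) (η := η) (lev₀ := (fun _ : Bond d (towerP L m (n + 1)) => n + 1)) (levB := levB) (c := ((η : ℂ))⁻¹)
              (R := adTransportW φ (fun _ : Bond d (towerP L m (n + 1)) => (1 : 𝔸ˣ)))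
              (S := adTransportW φ fun _ : Bond d (towerP L m (n + 1)) => (1 : 𝔸ˣ)⁻¹) (Δ₁ := hessOp φ η (fun _ : Bond d (towerP L m (n + 1)) => (1 : 𝔸ˣ)) τ)
              (Rr := RofUk L m n φ η (fun _ : Bond d (towerP L m (n + 1)) => (1 : 𝔸ˣ)))
              (Q := (QkW L m n φ (fun _ : Bond d (towerP L m (n + 1)) => (1 : 𝔸ˣ)) hL (fun _ => 0) (fun _ => by norm_num)
                (perCfg_UlevOf_one_mem_U1 L m (n + 1)) (norm_Wcx_UlevOf_one_sub_one_le L m (n + 1) (fun _ => 0) (fun _ => le_rfl)) (c₀ := c₀) (c₁ := c₁))) (a := a)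
              φ hpos₁ hQ1 (fun _ : Bond d (towerP L m (n + 1)) × Fin d => n + 1) (nabla115 η (fun _ : Bond d (towerP L m (n + 1)) => (1 : 𝔸ˣ)))) B‖ ≤
          K * ((j₀ + α) + δW) := by
  obtain ⟨α₁, j₁, ε₄, εC, Rb, r, K, hα₁, hj₁, hε₄, hεC, hRb, hr, hK, H⟩ :=
    cur_chart_tower_pi_lipschitz_at_flat_lattice_uniform_C hd L hL hL2 hL3 φ hMφ hMφ' hφ hφ' hstar ha ha' hϱ0 hϱ1 τ hτ hCτ hτm hMτ hρw hτ₁ hτ₂ hφτ AQ b hM₂ hrepr hG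
      hα₀ hα3 hα4 hρ0 hρ hρc hC₄ ha₃ (zero_le_one : (0 : ℝ) ≤ 1) (zero_le_one : (0 : ℝ) ≤ 1) hα8 hr' hr₇ h7s' h7c' h7r'1 h7s h7c
  refine ⟨α₁, j₁, ε₄, εC, Rb, r, K, hα₁, hj₁, hε₄, hεC, hRb, hr, hK, ?_⟩
  intro n η _ hηL c₀ c₁ _ _ hw hρ'' m _ hm U αU hα0 hα1 hαL hU1 hreg εU hεU hε1 hUε hLb α hα hαle hUst hUb hUη hUw hpl hUgrad hRlev hεg hAQ hpos' hpos hc₀η j₀ hJ hj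
    hposπ hQ hpos'₁ hpos₁ hQ1 hUG levB W₁ W₂ hW₁ hW₂ δW hδW0 hδW B hBb
  have hw1 := topLevel_weights (ι := Bond d (towerP L m (n + 1))) (L := (L : ℝ)) hηL 1
  have hw2 := topLevel_weights (ι := Bond d (towerP L m (n + 1)) × Fin d) (L := (L : ℝ)) hηL 2
  have hw3 := topLevel_weights (ι := Bond d (towerP L m (n + 1))) (L := (L : ℝ)) hηL 3
  have hwB := zeroExp_weights (L := (L : ℝ)) (η := η) levB
  exact H n η hηL c₀ c₁ hw hρ'' m hm U αU hα0 hα1 hαL hU1 hreg εU hεU hε1 hUε hLb α hα hαle hUst hUb hUη hUw hpl hUgrad hRlev hεg hAQ hpos' hpos hc₀η j₀ hJ hj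
    hposπ hQ hpos'₁ hpos₁ hQ1 hUG (fun _ => n + 1) levB (fun _ => n + 1) (fun _ => le_rfl) hw1.1 hw2.1 hw1.2 hw3.2 hwB hW₁ hW₂ hδW0 hδW B hBb

end Summit.QuantumFields.BalabanUV.T4Continuum.NE9CurChartTowerPiLipschitzAtFlatLatticeUniformCTopLevel

end
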